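import Mathlib
import Summits.ValiantsHypothesis.ValiantsHypothesis.Theorems.NewtonUnitEquationsNewtonTauWeakK3Defs
import Summits.ValiantsHypothesis.ValiantsHypothesis.Theorems.NewtonUnitEquationsNewtonTauWeakCornerWords

/-!
# `NewtonTauWeak` (stmt-ValiantsHypothesis-5904), line `binomial-normal-form`, `K = 3` rung: WORDS
# (separated products in the Laurent ring and the two-product corner lemma)

Second file of the `K = 3` global count (sub-stub `fixedKCoincidence_t2_K3`; plan
`Cruxes/NewtonTauWeak/Lines/binomial-normal-form-ltc.md` §2–§5).  A SEPARATED PRODUCT is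
`Π_e P_e(X^{ε_e})` for univariate `P_e ∈ ℂ[s]` substituted along directions `ε_e ∈ ℤ²` (in the Laurent ring,
`P(X^{ε}) = aeval (T ε) P`).  Contents:

* `aeval_T_eq_sum`, `prod_aeval_T_eq_sum` — the WORD EXPANSION `Π_e P_e(X^{ε_e}) = Σ_{n ∈ box} sepCoeff P n · X^{push ε n}`
  over the word box of the corner model (`…CornerDefs.lean`: `push`, `sepCoeff`, `box`), and `coeff_sum_smul_T`
  (coefficients are fibre sums);
* `isBot_prod_sub_prod` — the TWO-PRODUCT CORNER LEMMA (the `K = 2` ray lemma of the card, §3 "K = 2 true"): for a weight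
  injective on `ℤ²` and positive on pairwise non-parallel directions, the strict bottom of `Π_e A_e(X^{ε_e}) − Π_e B_e(X^{ε_e})`
  with `A_e(0) = B_e(0) ≠ 0` is the ORDER POINT `ord(A_e − B_e)·ε_e` of one direction, with the explicit nonzero coefficient.

No definitions. [folklore; KPTT arXiv:1308.2286 Conj. 1 context]
-/

-- the namespace mandated for this Theorems file repeats the component `ValiantsHypothesis`
set_option linter.dupNamespace false

noncomputable section

open scoped BigOperators Polynomial
open Summit.ValiantsHypothesis.ValiantsHypothesis.Theorems.NewtonTauWeakCorner
  (wt wt_add wt_zsmul wt_push push sepCoeff box push_single single_mem_box)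

namespace Summit.ValiantsHypothesis.ValiantsHypothesis.Theorems.NewtonTauWeakK3k5

open Summit.ValiantsHypothesis.ValiantsHypothesis.Theorems.NewtonTauWeakK3

/-! ## Word expansion of separated products -/

/-- A scalar multiple of a monomial is a `single`. [folklore] -/
theorem smul_T (c : ℂ) (z : Fin 2 → ℤ) : c • T z = AddMonoidAlgebra.single z c := by
  rw [T, AddMonoidAlgebra.smul_single, smul_eq_mul, mul_one]

/-- Substitution of a univariate polynomial along a direction, expanded: `P(X^δ) = Σ_{k ≤ D} [s^k]P · X^{kδ}`. [folklore] -/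
theorem aeval_T_eq_sum (δ : Fin 2 → ℤ) (P : ℂ[X]) {D : ℕ} (hP : P.natDegree ≤ D) :
    Polynomial.aeval (T δ) P = ∑ k ∈ Finset.range (D + 1), P.coeff k • T ((k : ℤ) • δ) := by
  conv_lhs => rw [Polynomial.as_sum_range' P (D + 1) (Nat.lt_succ_of_le hP)]
  rw [map_sum]
  refine Finset.sum_congr rfl fun k _ => ?_
  rw [Polynomial.aeval_monomial, T_pow, ← Algebra.smul_def]

/-- Constant term of a substituted polynomial along a direction of positive weight... as a coefficient at the origin:
`[X^0] P(X^δ) = P(0)` when `δ ≠ 0`. [folklore] -/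
theorem coeff_aeval_T_zero (δ : Fin 2 → ℤ) (hδ : δ ≠ 0) (P : ℂ[X]) :
    (Polynomial.aeval (T δ) P).coeff 0 = P.coeff 0 := by
  classical
  rw [aeval_T_eq_sum δ P le_rfl, AddMonoidAlgebra.coeff_sum, Finsupp.finsetSum_apply,
    Finset.sum_eq_single_of_mem 0 (Finset.mem_range.mpr (Nat.succ_pos _))]
  · rw [coeff_smul, coeff_T]; simp
  · intro k _ hk
    rw [coeff_smul, coeff_T, if_neg, mul_zero]
    intro h
    have : (k : ℤ) • δ ≠ 0 := smul_ne_zero (by exact_mod_cast hk) hδ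
    exact this h

/-- **Word expansion** of a separated product over the word box: `Π_e P_e(X^{ε_e}) = Σ_{n ∈ box s D} sepCoeff P n · X^{push ε n}`
whenever all degrees are `≤ D`. [folklore] -/
theorem prod_aeval_T_eq_sum {s D : ℕ} (ε : Fin s → Fin 2 → ℤ) (P : Fin s → ℂ[X]) (hP : ∀ e, (P e).natDegree ≤ D) :
    ∏ e, Polynomial.aeval (T (ε e)) (P e) = ∑ n ∈ box s D, sepCoeff P n • T (push ε n) := by
  have h : ∀ e, Polynomial.aeval (T (ε e)) (P e) =
      ∑ k ∈ Finset.range (D + 1), (P e).coeff k • T ((k : ℤ) • ε e) := fun e => aeval_T_eq_sum (ε e) (P e) (hP e)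
  simp_rw [h]
  rw [Finset.prod_univ_sum]
  refine Finset.sum_congr rfl fun n _ => ?_
  simp_rw [smul_T]
  rw [AddMonoidAlgebra.prod_single]
  rfl

/-- Coefficients of a finite sum of scaled monomials are the fibre sums of the scalars. [folklore] -/
theorem coeff_sum_smul_T {ι : Type*} (s : Finset ι) (a : ι → ℂ) (z : ι → Fin 2 → ℤ) (y : Fin 2 → ℤ)
    [DecidablePred fun i => z i = y] :
    (∑ i ∈ s, a i • T (z i)).coeff y = ∑ i ∈ s with z i = y, a i := by
  classical
  rw [AddMonoidAlgebra.coeff_sum, Finsupp.finsetSum_apply, Finset.sum_filter]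
  refine Finset.sum_congr rfl fun i _ => ?_
  rw [coeff_smul, coeff_T]
  split_ifs <;> simp

/-- Every exponent of a separated product with nonzero coefficient is pushed from a word with nonzero separated
coefficient. [folklore] -/
theorem exists_word_of_coeff_ne_zero {s D : ℕ} (ε : Fin s → Fin 2 → ℤ) (a : (Fin s → ℕ) → ℂ) (y : Fin 2 → ℤ)
    (h : (∑ n ∈ box s D, a n • T (push ε n)).coeff y ≠ 0) : ∃ n ∈ box s D, push ε n = y ∧ a n ≠ 0 := by
  classical
  rw [coeff_sum_smul_T] at h
  obtain ⟨n, hn, hne⟩ := Finset.exists_ne_zero_of_sum_ne_zero h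
  exact ⟨n, (Finset.mem_filter.mp hn).1, (Finset.mem_filter.mp hn).2, hne⟩

/-- Exponents of a separated product weigh at least `0` for a weight positive on the directions; more precisely the
weight of a pushed word is the nonnegative combination `Σ_e n_e ⟨ω, ε_e⟩`. [folklore] -/
theorem wt_push_nonneg {s : ℕ} (ε : Fin s → Fin 2 → ℤ) (ω : Fin 2 → ℝ) (hpos : ∀ e, 0 < wt ω (ε e)) (n : Fin s → ℕ) :
    0 ≤ wt ω (push ε n) := by
  rw [wt_push]
  exact Finset.sum_nonneg fun e _ => mul_nonneg (Nat.cast_nonneg _) (hpos e).le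

/-- A single letter bounds the weight of a pushed word from below. [folklore] -/
theorem mul_wt_le_wt_push {s : ℕ} (ε : Fin s → Fin 2 → ℤ) (ω : Fin 2 → ℝ) (hpos : ∀ e, 0 < wt ω (ε e)) (n : Fin s → ℕ)
    (e : Fin s) : (n e : ℝ) * wt ω (ε e) ≤ wt ω (push ε n) := by
  rw [wt_push]
  exact Finset.single_le_sum (f := fun x => (n x : ℝ) * wt ω (ε x))
    (fun x _ => mul_nonneg (Nat.cast_nonneg _) (hpos x).le) (Finset.mem_univ e)

/-- Equality in the single-letter bound forces a pure power word. [folklore] -/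
theorem eq_single_of_mul_wt_eq_wt_push {s : ℕ} (ε : Fin s → Fin 2 → ℤ) (ω : Fin 2 → ℝ) (hpos : ∀ e, 0 < wt ω (ε e))
    (n : Fin s → ℕ) (e : Fin s) (h : wt ω (push ε n) = (n e : ℝ) * wt ω (ε e)) : n = Pi.single e (n e) := by
  classical
  rw [wt_push, ← Finset.sum_erase_add _ _ (Finset.mem_univ e)] at h
  have hzero : ∑ x ∈ Finset.univ.erase e, (n x : ℝ) * wt ω (ε x) = 0 := by linarith
  have hall := (Finset.sum_eq_zero_iff_of_nonneg fun x _ => mul_nonneg (Nat.cast_nonneg _) (hpos x).le).mp hzero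
  funext x
  by_cases hx : x = e
  · subst hx; simp
  · have := hall x (Finset.mem_erase.mpr ⟨hx, Finset.mem_univ x⟩)
    rcases mul_eq_zero.mp this with h0 | h0
    · simp [hx, Nat.cast_eq_zero.mp h0]
    · exact absurd h0 (hpos x).ne'

/-- Separated coefficient of a pure power word (general constant terms). [folklore] -/
theorem sepCoeff_single_eq {s : ℕ} (U : Fin s → ℂ[X]) (e : Fin s) (k : ℕ) :
    sepCoeff U (Pi.single e k) = (U e).coeff k * ∏ x ∈ Finset.univ.erase e, (U x).coeff 0 := by
  classical
  unfold sepCoeff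
  rw [← Finset.mul_prod_erase _ _ (Finset.mem_univ e), Pi.single_eq_same]
  congr 1
  exact Finset.prod_congr rfl fun x hx => by rw [Pi.single_eq_of_ne (Finset.ne_of_mem_erase hx)]

/-! ## The two-product corner lemma -/

/-- **Two-product corner lemma** (the `K = 2` ray lemma).  Let `ω` be a weight injective on `ℤ²`, positive on
directions `ε_e` no two of which are positively parallel, and let `A_e, B_e ∈ ℂ[s]` have equal NONZERO constant terms,
not all `A_e = B_e`.  Then the strict `ω`-bottom of `Π_e A_e(X^{ε_e}) − Π_e B_e(X^{ε_e})` is the order point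
`ord(A_e − B_e)·ε_e` of some direction with `A_e ≠ B_e`, and its coefficient is
`trailingCoeff(A_e − B_e) · Π_{x ≠ e} A_x(0)`.  (Every word with different separated coefficients has a letter
`n_x ≥ ord(A_x − B_x)`, so it weighs at least the lightest order point, with equality only for that pure word.)
[folklore; card `binomial-normal-form-ltc` §3] -/
theorem isBot_prod_sub_prod {s : ℕ} (ε : Fin s → Fin 2 → ℤ) (ω : Fin 2 → ℝ) (hω : Function.Injective (wt ω))
    (hpos : ∀ e, 0 < wt ω (ε e))
    (hE : ∀ e e' : Fin s, ∀ k k' : ℕ, 1 ≤ k → (k : ℤ) • ε e = (k' : ℤ) • ε e' → e = e')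
    (A B : Fin s → ℂ[X]) (h0 : ∀ e, (A e).coeff 0 = (B e).coeff 0) (h0' : ∀ e, (A e).coeff 0 ≠ 0)
    (hne : ∃ e, A e ≠ B e) :
    ∃ e, A e ≠ B e ∧
      IsBot ω (∏ i, Polynomial.aeval (T (ε i)) (A i) - ∏ i, Polynomial.aeval (T (ε i)) (B i))
        (((A e - B e).natTrailingDegree : ℤ) • ε e) ∧
      (∏ i, Polynomial.aeval (T (ε i)) (A i) - ∏ i, Polynomial.aeval (T (ε i)) (B i)).coeff
          (((A e - B e).natTrailingDegree : ℤ) • ε e) =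
        (A e - B e).trailingCoeff * ∏ x ∈ Finset.univ.erase e, (A x).coeff 0 := by
  classical
  -- a common degree bound and the word expansion of the difference
  set D : ℕ := Finset.univ.sup fun e => max (A e).natDegree (B e).natDegree with hD
  have hAD : ∀ e, (A e).natDegree ≤ D := fun e =>
    (le_max_left _ _).trans (Finset.le_sup (f := fun e => max (A e).natDegree (B e).natDegree) (Finset.mem_univ e))
  have hBD : ∀ e, (B e).natDegree ≤ D := fun e =>
    (le_max_right _ _).trans (Finset.le_sup (f := fun e => max (A e).natDegree (B e).natDegree) (Finset.mem_univ e))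
  set F : Laurent := ∏ i, Polynomial.aeval (T (ε i)) (A i) - ∏ i, Polynomial.aeval (T (ε i)) (B i) with hF
  have hFexp : F = ∑ n ∈ box s D, (sepCoeff A n - sepCoeff B n) • T (push ε n) := by
    rw [hF, prod_aeval_T_eq_sum ε A hAD, prod_aeval_T_eq_sum ε B hBD, ← Finset.sum_sub_distrib]
    exact Finset.sum_congr rfl fun n _ => by rw [sub_smul]
  -- orders of the active directions and the lightest order point
  set o : Fin s → ℕ := fun e => (A e - B e).natTrailingDegree with ho
  have ho1 : ∀ e, A e ≠ B e → 1 ≤ o e := by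
    intro e he
    refine Polynomial.le_natTrailingDegree (sub_ne_zero.mpr he) fun m hm => ?_
    have : m = 0 := by omega
    subst this
    rw [Polynomial.coeff_sub, h0 e, sub_self]
  have hoD : ∀ e, o e ≤ D := fun e =>
    (Polynomial.natTrailingDegree_le_natDegree _).trans
      ((Polynomial.natDegree_sub_le _ _).trans (max_le (hAD e) (hBD e)))
  set Act : Finset (Fin s) := Finset.univ.filter fun e => A e ≠ B e with hAct
  have hActne : Act.Nonempty := by
    obtain ⟨e, he⟩ := hne
    exact ⟨e, Finset.mem_filter.mpr ⟨Finset.mem_univ e, he⟩⟩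
  obtain ⟨e₀, he₀, hmin⟩ := Act.exists_min_image (fun e => (o e : ℝ) * wt ω (ε e)) hActne
  have hA₀ : A e₀ ≠ B e₀ := (Finset.mem_filter.mp he₀).2
  set θ : ℝ := (o e₀ : ℝ) * wt ω (ε e₀) with hθ
  set n₀ : Fin s → ℕ := Pi.single e₀ (o e₀) with hn₀
  have hpush₀ : push ε n₀ = ((o e₀ : ℕ) : ℤ) • ε e₀ := push_single ε e₀ (o e₀)
  have hwt₀ : wt ω (push ε n₀) = θ := by
    rw [hpush₀, wt_zsmul]; push_cast; rfl
  -- KEY: a word with different separated coefficients weighs at least `θ`, with equality only for `n₀`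
  have key : ∀ n : Fin s → ℕ, sepCoeff A n ≠ sepCoeff B n →
      θ ≤ wt ω (push ε n) ∧ (wt ω (push ε n) = θ → n = n₀) := by
    intro n hn
    obtain ⟨e, he⟩ : ∃ e, (A e).coeff (n e) ≠ (B e).coeff (n e) := by
      by_contra hall
      push Not at hall
      exact hn (Finset.prod_congr rfl fun e _ => hall e)
    have hAe : A e ≠ B e := fun heq => he (by rw [heq])
    have hcoeff : (A e - B e).coeff (n e) ≠ 0 := by rwa [Polynomial.coeff_sub, sub_ne_zero]
    have hoe : o e ≤ n e := Polynomial.natTrailingDegree_le_of_ne_zero hcoeff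
    have h1 : θ ≤ (o e : ℝ) * wt ω (ε e) := hmin e (Finset.mem_filter.mpr ⟨Finset.mem_univ e, hAe⟩)
    have h2 : (o e : ℝ) * wt ω (ε e) ≤ (n e : ℝ) * wt ω (ε e) :=
      mul_le_mul_of_nonneg_right (by exact_mod_cast hoe) (hpos e).le
    have h3 : (n e : ℝ) * wt ω (ε e) ≤ wt ω (push ε n) := mul_wt_le_wt_push ε ω hpos n e
    refine ⟨h1.trans (h2.trans h3), fun heq => ?_⟩
    have e3 : wt ω (push ε n) = (n e : ℝ) * wt ω (ε e) := le_antisymm (by linarith) h3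
    have e2 : (o e : ℝ) = (n e : ℝ) := by
      have : (o e : ℝ) * wt ω (ε e) = (n e : ℝ) * wt ω (ε e) := by linarith
      exact mul_right_cancel₀ (hpos e).ne' this
    have e2' : n e = o e := by exact_mod_cast e2.symm
    have hsingle := eq_single_of_mul_wt_eq_wt_push ε ω hpos n e e3
    -- the order point of `e` has the weight of the order point of `e₀`: same point, same direction
    have e1 : wt ω (((o e : ℕ) : ℤ) • ε e) = wt ω (((o e₀ : ℕ) : ℤ) • ε e₀) := by
      rw [wt_zsmul, wt_zsmul]; push_cast; linarith
    have hpt := hω e1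
    have hee : e = e₀ := hE e e₀ (o e) (o e₀) (ho1 e hAe) hpt
    subst hee
    rw [hsingle, e2']
  -- the coefficient at the order point of `e₀`
  have hcoeff₀ : F.coeff (push ε n₀) = (A e₀ - B e₀).trailingCoeff * ∏ x ∈ Finset.univ.erase e₀, (A x).coeff 0 := by
    rw [hFexp, coeff_sum_smul_T, Finset.sum_eq_single_of_mem n₀]
    · rw [hn₀, sepCoeff_single_eq, sepCoeff_single_eq, Polynomial.trailingCoeff, Polynomial.coeff_sub, sub_mul]
      congr 2
      exact Finset.prod_congr rfl fun x _ => (h0 x).symm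
    · exact Finset.mem_filter.mpr ⟨single_mem_box e₀ (hoD e₀), rfl⟩
    · intro n hn hne'
      by_contra hdiff
      have hdiff : sepCoeff A n ≠ sepCoeff B n := fun h => hdiff (by rw [h, sub_self])
      have hwn : wt ω (push ε n) = θ := by rw [(Finset.mem_filter.mp hn).2, hwt₀]
      exact hne' ((key n hdiff).2 hwn)
  have hc0 : (A e₀ - B e₀).trailingCoeff * ∏ x ∈ Finset.univ.erase e₀, (A x).coeff 0 ≠ 0 :=
    mul_ne_zero (Polynomial.trailingCoeff_nonzero_iff_nonzero.mpr (sub_ne_zero.mpr hA₀))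
      (Finset.prod_ne_zero_iff.mpr fun x _ => h0' x)
  refine ⟨e₀, hA₀, ?_, by rw [← hpush₀]; exact hcoeff₀⟩
  rw [← hpush₀]
  refine ⟨by rw [hcoeff₀]; exact hc0, fun z' hz' hne' => ?_⟩
  rw [hFexp] at hz'
  obtain ⟨n, -, hpush, hn⟩ := exists_word_of_coeff_ne_zero ε _ z' hz'
  obtain ⟨hle, heq⟩ := key n (sub_ne_zero.mp hn)
  rw [hwt₀, ← hpush]
  refine lt_of_le_of_ne hle fun h => hne' ?_
  rw [← hpush, heq h.symm]

end Summit.ValiantsHypothesis.ValiantsHypothesis.Theorems.NewtonTauWeakK3k5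

end
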